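import Summits.BirchSwinnertonDyer.BirchSwinnertonDyer.Theorems.ResidualThetaTransportAtTwoSignedMuVanishingAtTwoPlusSel2

/-!
# Line `sign-dichotomy` for crux `SignedMuSeedAtTwoPlus` (stmt-BirchSwinnertonDyer-21438) — crux-ideate r1 k2 (g3)

RESIDUAL SIGN DICHOTOMY + COLEMAN-RATIO TIE-BREAK. Inside `H¹(ℚ_{2,∞}, W[2]) = E(ℚ_{2,∞})/2` (an
`Ω = 𝔽₂⟦T⟧`-module of corank 2) the two Kobayashi conditions `L_± = (E^± + 2E)/2E` have corank 1 each,
`L_+ + L_- =` everything and `L_+ ∩ L_- = 𝔽₂·d̄₀` (finite) — all from the tree's HONDA⁺@2 system over the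
`ℤ₂`-layers (`E = E⁺ + E⁻ + 2E`, `E⁺ ∩ E⁻ = E(ℚ₂)`, p591589) and `E(ℚ_{2,∞})[2] = 0`. If the residual fine
group `Sel₀(ℚ_∞, W)[2]` is finite, the relaxed-at-2 residual Selmer group has `Ω`-corank `≤ 1` (global Euler
characteristic over the totally real layers, `W[2] ≅ 𝔽₂[C₂]` at `∞` because `Δ_W < 0`, and `Ш¹_Iw` bounded by
the fine group), so `Sel⁺[2]` and `Sel⁻[2]` — two `Γ`-stable subgroups with finite intersection — cannot BOTH be
infinite: (S1) `Sel₀[2]` finite ⇒ `Sel⁺[2]` finite ∨ `Sel⁻[2]` finite. No main conjecture, no Euler system, no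
Coleman surjectivity (contrast Lei–Sujatha 2021 Thm 1.2 / Lei–Lim 2022 Cor 4.6: odd `p`, under Kato's IMC).
The sign is then selected by a RATIO: for ANY non-zero global Iwasawa class `z` (rank one!) the point
`[Col⁺(loc₂ z) : Col⁻(loc₂ z)] ∈ ℙ¹(Frac Λ)` is the same, and Kato's `z` (used only RATIONALLY: `z ≠ 0` by
Rohrlich, explicit reciprocity `⊗ ℚ₂`) puts it at `[L♭ : L♯]`; so with (S1): `Sel⁺[2]` infinite ∧ `Sel⁻[2]` finite
⇒ `μ(L_{Kob,+}) > μ(L_{Kob,−})`, i.e. `μ(Lplus) < μ(Lminus)` in the tree's (Pollack) labelling (S2). The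
tie-break (S3) `μ(Lminus) ≤ μ(Lplus)` is normalisation-free (periods / Manin constant cancel), implied by the
sibling crux 21437 plus 2-integrality of `ϖ·Lplus`, and per class a finite modular-symbol check. (S4) is
Conjecture A at 2 in residual form (shared with line `fine-plus-split`, certified per class by cubic class
numbers); (S5) is Pollack's pair at `p = 2` (the tree's fact carries `p ≠ 2`). BSD is not proved by any of this.
-/

open WeierstrassCurve Literature.NumberTheory.EllipticCurves
open Literature.NumberTheory.EllipticCurves.Kobayashi2003
open Literature.NumberTheory.EllipticCurves.Rank1Residual
open Literature.NumberTheory.EllipticCurves.ModularForms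
open Summit.BirchSwinnertonDyer.Rank1Residual.Supersingular Summit.BirchSwinnertonDyer.Rank1Residual.X1
open Summit.BirchSwinnertonDyer.BirchSwinnertonDyer.Theses.ResidualThetaTransportAtTwo
open scoped MatrixGroups ModularForm
open CongruenceSubgroup

noncomputable section

namespace Summit.BirchSwinnertonDyer.BirchSwinnertonDyer.Cruxes.SignedMuSeedAtTwoPlus.SignDichotomy

/-- `Sel^ε(W/ℚ_∞)[2]` is finite (the SEL2 currency of the door p580570; `ε = 1` plus, `ε = -1` minus). -/
def SignedResidualFinite (W : WeierstrassCurve ℚ) [W.IsElliptic] (κ : ZpExtension ℚ 2) (ε : ℤˣ) : Prop :=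
  {s : signedSelmerInfty W κ ε | 2 • s = 0}.Finite

/-- `Sel₀(ℚ_∞, W[2^∞])[2]` is finite (residual Conjecture A at `(W, 2)`; weaker than `X₀` f.g. over `ℤ₂`). -/
def FineResidualFinite (W : WeierstrassCurve ℚ) [W.IsElliptic] (κ : ZpExtension ℚ 2) : Prop :=
  {s : W.fineSelmerInfty κ | 2 • s = 0}.Finite

/-! ## Registered stub statements -/

/-- **S1 (size M–L, the new theorem): RESIDUAL SIGN DICHOTOMY AT 2.** For `W/ℚ` good supersingular at `2`
with `a₂ = 0` and `Δ_W < 0`, at every cyclotomic `κ`: `Sel₀[2]` finite ⇒ `Sel⁺[2]` finite or `Sel⁻[2]` finite.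
Proof plan: (i) LOCAL JOINT LEMMA `(Sel⁺ ⊓ Sel⁻)[2]` is finite modulo `Sel₀[2]` because
`(E⁺+2E) ∩ (E⁻+2E) = (E⁺ ∩ E⁻) + 2E = E(ℚ₂) + 2E` layerwise (HONDA⁺@2 decomposition + `E⁺ ∩ E⁻ = E(ℚ₂)`
by torsion-freeness of `E(F_n)/E(F_{n-1})`, `E(ℚ_{2,∞})[2] = 0`); (ii) RANK LEMMA the relaxed-at-2 residual
Selmer group has `Ω`-corank `1 + corank H² ≤ 1 + corank Sel₀[2] = 1` (Tate global Euler characteristic over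
`F_n = ℚ(ζ_{2^{n+2}})⁺`, real terms `dim W[2] − dim W[2]^c = 1`; `H² ↔ Ш¹_Iw` by Poitou–Tate, bounded by
`Sel₀`); (iii) two `Γ`-stable subgroups with finite intersection in a corank-`≤ 1` module are not both infinite. -/
def SignDichotomyAtTwo : Prop :=
  ∀ (W : WeierstrassCurve ℚ) [W.IsElliptic] [W.IsGloballyMinimal], GoodSS W 2 → W.frobeniusTrace 2 = 0 →
    W.Δ < 0 → ∀ (κ : ZpExtension ℚ 2), κ.IsCyclotomic → FineResidualFinite W κ →
      SignedResidualFinite W κ 1 ∨ SignedResidualFinite W κ (-1)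

/-- **S2 (size XL, rational signed reciprocity at 2): THE COLEMAN RATIO.** If `Sel₀[2]` is finite, `Sel⁺[2]`
infinite and `Sel⁻[2]` finite, then for the newform `f` of `W` and every Pollack pair at `2`,
`μ(Lplus) < μ(Lminus)` (tree labelling: `kobayashiL 1 Lplus Lminus = Lminus` is the `Sel⁺` function).
Plan: `ξ` a generator (mod torsion) of `loc₂ H¹_Iw(ℚ_S/ℚ_∞, T₂W)` (rank 1 from (S1)'s count, no Kato);
`Sel⁺[2]` infinite ⇒ `Col⁺ξ ∈ 2Λ`; `Sel⁻[2]` finite ⇒ `μ(Col⁻ξ) ≤ μ(coker Col⁻) = 0` (joint Coleman image at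
`2`, Kurihara–Pollack / Lei–Lim Lemma 2.2 shape); Kato's `z = θ·ξ`, `θ ∈ Λ[1/2] ∖ 0` (Rohrlich), and
`Col^±(loc₂ z) ≐ L^±_{Kob}` in `Λ ⊗ ℚ₂` (Kato Thm 12.5 dual-exp interpolation + Kobayashi §8 at 2) give
`μ(L_{Kob,+}) − μ(L_{Kob,−}) = μ(Col⁺ξ) − μ(Col⁻ξ) ≥ 1`. No integrality of `z`, no big image. -/
def ColemanRatioAtTwo : Prop :=
  ∀ (W : WeierstrassCurve ℚ) [W.IsElliptic] [W.IsGloballyMinimal], GoodSS W 2 → W.frobeniusTrace 2 = 0 →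
    W.Δ < 0 → ∀ (κ : ZpExtension ℚ 2), κ.IsCyclotomic → FineResidualFinite W κ →
      ¬ SignedResidualFinite W κ 1 → SignedResidualFinite W κ (-1) →
      ∀ (N : ℕ) [NeZero N] (f : CuspForm (Gamma0 N) 2), IsNewformOf W f →
        ∀ (Lplus Lminus : IwasawaAlgebra 2), IsPollackPair f 2 Lplus Lminus →
          MuLambda.mu Lplus < MuLambda.mu Lminus

/-- **S3 (size M–L, analytic, normalisation-free): THETA PARITY ORDER AT 2** — the tie-break. For every
Pollack pair of the newform of `W` at `2`: `μ(Lminus) ≤ μ(Lplus)` («the `Sel⁺`-matched modular-symbol series is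
no more 2-divisible than the other one»). Implied by 21437 (`μ(ϖ Lminus) = 0`) together with `ϖ Lplus ∈ Λ`;
per class: one even-layer Mazur–Tate element of `f` at `2` with an odd coefficient (`μ(θ_{2k})` is
non-increasing in `k` and stabilises at `μ(Lminus)`). Expected true for all `W` (Pollack / Perrin-Riou `μ = 0`). -/
def ThetaParityOrderAtTwo : Prop :=
  ∀ (W : WeierstrassCurve ℚ) [W.IsElliptic] [W.IsGloballyMinimal], GoodSS W 2 → W.frobeniusTrace 2 = 0 →
    W.Δ < 0 → ∀ (N : ℕ) [NeZero N] (f : CuspForm (Gamma0 N) 2), IsNewformOf W f →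
      ∀ (Lplus Lminus : IwasawaAlgebra 2), IsPollackPair f 2 Lplus Lminus →
        MuLambda.mu Lminus ≤ MuLambda.mu Lplus

/-- **S4 (conjecture-grade uniformly, per class a class-number computation; SHARED with line `fine-plus-split`):
residual Conjecture A at 2 on the habitat⁺** — `Sel₀(ℚ_∞, W)[2]` finite for every habitat⁺ curve and cyclotomic
`κ` (⇐ `X₀(W/ℚ_∞)` f.g. over `ℤ₂` ⇐ Lim 2017 Thm 3.5 at two + `μ₂(ℚ(W[2])^{cyc}) = 0`, e.g. `h(ℚ(x(P)))` odd). -/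
def FineResidualHabitatAtTwo : Prop :=
  ∀ (W : WeierstrassCurve ℚ) [W.IsElliptic] [W.IsGloballyMinimal], ¬ W.HasCM → W.analyticRank = 0 →
    GoodSS W 2 → W.frobeniusTrace 2 = 0 → W.Δ < 0 →
    ∀ (κ : ZpExtension ℚ 2), κ.IsCyclotomic → FineResidualFinite W κ

/-- **S5 (size S–M, literature gap made explicit): POLLACK PAIR SUPPLY AT 2** — every `W/ℚ` good supersingular
at `2` with `a₂ = 0` has a newform (modularity) admitting a Pollack pair at `p = 2` in the tree's conventions
(Pollack 2003 Thm 5.6 at `p = 2`; the tree's `pollack_exists_plusMinusPAdicLFunction` is guarded `p ≠ 2`;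
Sprung's `♯/♭` pair at `2` EXISTS as a tree theorem `Sprung2017.exists_isSprungPair_two`). Also the cheapest
falsifier of the whole analytic side of the route, which quantifies over such pairs. -/
def PollackPairSupplyAtTwo : Prop :=
  ∀ (W : WeierstrassCurve ℚ) [W.IsElliptic] [W.IsGloballyMinimal], GoodSS W 2 → W.frobeniusTrace 2 = 0 →
    ∃ (N : ℕ) (_ : NeZero N) (f : CuspForm (Gamma0 N) 2), IsNewformOf W f ∧
      ∃ (Lplus Lminus : IwasawaAlgebra 2), IsPollackPair f 2 Lplus Lminus

theorem stub_signDichotomyAtTwo : SignDichotomyAtTwo := by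
  sorry

theorem stub_colemanRatioAtTwo : ColemanRatioAtTwo := by
  sorry

theorem stub_thetaParityOrderAtTwo : ThetaParityOrderAtTwo := by
  sorry

theorem stub_fineResidualHabitatAtTwo : FineResidualHabitatAtTwo := by
  sorry

theorem stub_pollackPairSupplyAtTwo : PollackPairSupplyAtTwo := by
  sorry

/-! ## Assembly (sorry-free glue) and the registrar theorem -/

/-- GLUE (no sorry): with `A := W` through the SEL2-seed door (p580570). Given (S4) the fine residual group is
finite; if `Sel⁺[2]` were infinite, (S1) makes `Sel⁻[2]` finite, (S2) gives `μ(Lplus) < μ(Lminus)` for the pair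
supplied by (S5), contradicting (S3). -/
theorem SignedMuSeedAtTwoPlus_of_stubs (h1 : SignDichotomyAtTwo) (h2 : ColemanRatioAtTwo)
    (h3 : ThetaParityOrderAtTwo) (h4 : FineResidualHabitatAtTwo) (h5 : PollackPairSupplyAtTwo) :
    SignedMuSeedAtTwoPlus := by
  refine Theorems.SignedMuAtTwo.signedMuSeedAtTwoPlus_of_sel2Seed ?_
  intro W _ _ hCM hr hss ha hΔ
  refine ⟨W, ‹_›, ‹_›, hss, ha, ⟨AddEquiv.refl _, fun σ P ↦ rfl⟩, fun κ γ hκ hγ _ ↦ ?_⟩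
  have hF : FineResidualFinite W κ := h4 W hCM hr hss ha hΔ κ hκ
  by_contra hplus
  have hminus : SignedResidualFinite W κ (-1) := (h1 W hss ha hΔ κ hκ hF).resolve_left hplus
  obtain ⟨N, hN, f, hf, Lplus, Lminus, hPP⟩ := h5 W hss ha
  have hlt : MuLambda.mu Lplus < MuLambda.mu Lminus := h2 W hss ha hΔ κ hκ hF hplus hminus N f hf Lplus Lminus hPP
  have hle : MuLambda.mu Lminus ≤ MuLambda.mu Lplus := h3 W hss ha hΔ N f hf Lplus Lminus hPP
  exact absurd (lt_of_lt_of_le hlt hle) (lt_irrefl _)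

/-- **THE SKELETON THEOREM (registrar shape): the crux BY NAME from the declared stubs**; the only `sorry`s in
its closure are the five `stub_*` theorems. -/
theorem SignedMuSeedAtTwoPlus_of :
    Summit.BirchSwinnertonDyer.BirchSwinnertonDyer.Theses.ResidualThetaTransportAtTwo.SignedMuSeedAtTwoPlus :=
  SignedMuSeedAtTwoPlus_of_stubs stub_signDichotomyAtTwo stub_colemanRatioAtTwo stub_thetaParityOrderAtTwo
    stub_fineResidualHabitatAtTwo stub_pollackPairSupplyAtTwo

/-- Bonus (no sorry): the SYMMETRIC form — with (S1),(S2) and its mirror, `Sel₀[2]` finite and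
`μ(Lplus) = μ(Lminus)` force BOTH signed residual groups finite; recorded here only as the plus half used above:
fine finiteness + theta parity order + Coleman ratio + a pair ⇒ `Sel⁺[2]` finite, for ONE curve. -/
theorem signedResidualFinite_one_of_fine (h1 : SignDichotomyAtTwo) (h2 : ColemanRatioAtTwo)
    (h3 : ThetaParityOrderAtTwo) (W : WeierstrassCurve ℚ) [W.IsElliptic] [W.IsGloballyMinimal]
    (hss : GoodSS W 2) (ha : W.frobeniusTrace 2 = 0) (hΔ : W.Δ < 0) (κ : ZpExtension ℚ 2) (hκ : κ.IsCyclotomic)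
    (hF : FineResidualFinite W κ) {N : ℕ} [NeZero N] (f : CuspForm (Gamma0 N) 2) (hf : IsNewformOf W f)
    (Lplus Lminus : IwasawaAlgebra 2) (hPP : IsPollackPair f 2 Lplus Lminus) :
    SignedResidualFinite W κ 1 := by
  by_contra hplus
  have hminus : SignedResidualFinite W κ (-1) := (h1 W hss ha hΔ κ hκ hF).resolve_left hplus
  exact absurd (lt_of_lt_of_le (h2 W hss ha hΔ κ hκ hF hplus hminus N f hf Lplus Lminus hPP)
    (h3 W hss ha hΔ N f hf Lplus Lminus hPP)) (lt_irrefl _)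

end Summit.BirchSwinnertonDyer.BirchSwinnertonDyer.Cruxes.SignedMuSeedAtTwoPlus.SignDichotomy

end
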